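import Summits.MatrixMultiplication.MatrixMultiplication.Theorems.OutsiderSandwichAmortisedTable
import Summits.MatrixMultiplication.MatrixMultiplication.Theorems.OutsiderSandwichExchangeLevelTwo
import HarnessLib

/-!
# Laws of the amortised exchange table: composition, products, and the leaf

Route `OutsiderSandwich` (decomposition cell `decomp-mm`, lens 4, gen 28), support for the aside
leaf `BlockOneIsMM` (stmt-MatrixMultiplication-27147).  Continues `OutsiderSandwichAmortisedTable`.

* COMPOSITION `a(N + N', m) ≤ a(N, a(N', m))` (`amortisedNumber_add_le_comp`): the products of
  level `N'` are re-used as the copies of level `N`.  With the first row: `a(2, m) ≤ a(1, a(1, m))`,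
  so `r(2) = a(2,1) ≤ a(1,2) = 3` (the tree knows `r(2) = 2`) and **`a(2, 2) ≤ a(1, 3) ≤ 5`**:
  the two open asks are linked (`a(1,3) = 4 ⟹ a(2,2) ≤ 4`), and `3 ≤ a(2,2) ≤ 5`.
* PRODUCTS `a(N + N', m·m') ≤ a(N, m)·a(N', m')`.
* THE LEAF in amortised form: `BlockOneIsMM ⟺ ∀ θ > 0, ∃ N ≥ 1, ∃ m ≥ 1, a(N, m) ≤ m·2^{θN}`
  (`blockOneIsMM_iff_amortised`) — amortisation does not change the exponent, it only changes which
  finite certificates are available at a given level.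

## References
* D. Coppersmith, S. Winograd, *Matrix multiplication via arithmetic progressions*,
  J. Symbolic Comput. 9 (1990) 251–280, §7. [CoppersmithWinograd1990]
* V. Strassen, *The asymptotic spectrum of tensors*, J. reine angew. Math. 384 (1988) 102–152,
  Thm. 3.8. [Strassen1988]
-/

noncomputable section

set_option linter.dupNamespace false
set_option autoImplicit false

namespace Summit.MatrixMultiplication.MatrixMultiplication.Theorems.OutsiderSandwichAmortisedLaws

open Literature.Computability.AlgebraicComplexity
open Summit.MatrixMultiplication.MatrixMultiplication.Theorems.OutsiderSandwichCoupling (coupling₁)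
open Summit.MatrixMultiplication.MatrixMultiplication.Theorems.OutsiderSandwichExchangeRate
  (Helped blockOneIsMM_iff_exists_certificate)
open Summit.MatrixMultiplication.MatrixMultiplication.Theorems.OutsiderSandwichExchangeExponent
  (exchangeExponent exchangeNumber exchangeNumber_le exchangeExponent_nonneg
    blockOneIsMM_iff_exchangeExponent_eq_zero)
open Summit.MatrixMultiplication.MatrixMultiplication.Theorems.OutsiderSandwichAmortisedTable

/-! ## 1. Composition and products -/

/-- **Composition of certificates**: `(N', B', m)` and `(N, B, B')` give `(N + N', B, m)` —
the `B'` products of level `N'` serve as the `B'` copies of level `N`. [cite: Strassen1988, Thm. 3.8] -/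
theorem Amortised.comp {N N' B B' m : ℕ} (h : Amortised N B B') (h' : Amortised N' B' m) :
    Amortised (N + N') B m := by
  rw [amortised_iff] at h h' ⊢
  calc (m : TensorClass ℂ) * TensorClass.mk (matMulTensor ℂ 2 2 2) ^ (N + N')
      = (m : TensorClass ℂ) * TensorClass.mk (matMulTensor ℂ 2 2 2) ^ N' *
          TensorClass.mk (matMulTensor ℂ 2 2 2) ^ N := by ring
    _ ≤ (B' : TensorClass ℂ) * TensorClass.mk coupling₁ ^ N' *
          TensorClass.mk (matMulTensor ℂ 2 2 2) ^ N := TensorClass.mul_le_mul h' le_rfl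
    _ = (B' : TensorClass ℂ) * TensorClass.mk (matMulTensor ℂ 2 2 2) ^ N *
          TensorClass.mk coupling₁ ^ N' := by ring
    _ ≤ (B : TensorClass ℂ) * TensorClass.mk coupling₁ ^ N * TensorClass.mk coupling₁ ^ N' :=
        TensorClass.mul_le_mul h le_rfl
    _ = (B : TensorClass ℂ) * TensorClass.mk coupling₁ ^ (N + N') := by ring

/-- **`a(N + N', m) ≤ a(N, a(N', m))`**. [cite: Strassen1988, Thm. 3.8] -/
theorem amortisedNumber_add_le_comp (N N' m : ℕ) :
    amortisedNumber (N + N') m ≤ amortisedNumber N (amortisedNumber N' m) :=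
  amortisedNumber_le (Amortised.comp (amortised_amortisedNumber N _) (amortised_amortisedNumber N' m))

/-- **Products of certificates**: `(N, B, m)·(N', B', m') = (N + N', BB', mm')`.
[cite: Strassen1988, Thm. 3.8] -/
theorem Amortised.mul {N N' B B' m m' : ℕ} (h : Amortised N B m) (h' : Amortised N' B' m') :
    Amortised (N + N') (B * B') (m * m') :=
  OutsiderSandwichAmortised.amortised_mul h h'

/-- **`a(N + N', m·m') ≤ a(N, m)·a(N', m')`**. [cite: Strassen1988, Thm. 3.8] -/
theorem amortisedNumber_add_le_mul (N N' m m' : ℕ) :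
    amortisedNumber (N + N') (m * m') ≤ amortisedNumber N m * amortisedNumber N' m' :=
  amortisedNumber_le (Amortised.mul (amortised_amortisedNumber N m) (amortised_amortisedNumber N' m'))

/-! ## 2. Level two -/

/-- `a(2, 1) = r(2) = 2` (the tree's `exchangeNumber_two`). [cite: CoppersmithWinograd1990, §7] -/
theorem amortisedNumber_two_one : amortisedNumber 2 1 = 2 := by
  rw [amortisedNumber_one_right, OutsiderSandwichExchangeLevelTwo.exchangeNumber_two]

/-- **`a(2, 2) ≤ a(1, 3)`**: the level-two ask is dominated by the level-one ask.
[cite: CoppersmithWinograd1990, §7] -/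
theorem amortisedNumber_two_two_le_one_three : amortisedNumber 2 2 ≤ amortisedNumber 1 3 := by
  have h := amortisedNumber_add_le_comp 1 1 2
  rwa [amortisedNumber_one_two] at h

/-- **`3 ≤ a(2, 2) ≤ 5`**. [cite: CoppersmithWinograd1990, §7] -/
theorem amortisedNumber_two_two_mem : 3 ≤ amortisedNumber 2 2 ∧ amortisedNumber 2 2 ≤ 5 := by
  refine ⟨succ_le_amortisedNumber (by norm_num) (by norm_num), ?_⟩
  have h := amortisedNumber_two_two_le_one_three
  rcases amortisedNumber_one_three with h4 | h5 <;> omega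

/-- If the level-one ask closes at `4`, the level-two entry is at most `4`.
[cite: CoppersmithWinograd1990, §7] -/
theorem amortisedNumber_two_two_le_four_of (h : Amortised 1 4 3) : amortisedNumber 2 2 ≤ 4 := by
  have h4 : amortisedNumber 1 3 = 4 := amortisedNumber_one_three_eq_four_iff.2 h
  have := amortisedNumber_two_two_le_one_three
  omega

/-! ## 3. The leaf in amortised form -/

/-- **`BlockOneIsMM ⟺ ∀ θ > 0, ∃ N ≥ 1, ∃ m ≥ 1, a(N, m) ≤ m·2^{θN}`** — amortised certificates
decide the same exponent. [cite: Strassen1988, Thm. 3.8] -/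
theorem blockOneIsMM_iff_amortised :
    Theses.OutsiderSandwich.BlockOneIsMM ↔
      ∀ θ : ℝ, 0 < θ → ∃ N : ℕ, 1 ≤ N ∧ ∃ m : ℕ, 1 ≤ m ∧
        (amortisedNumber N m : ℝ) ≤ m * (2 : ℝ) ^ (θ * N) := by
  constructor
  · intro H θ hθ
    obtain ⟨N, hN, B, hB, hle⟩ := (blockOneIsMM_iff_exists_certificate.1 H) θ hθ
    refine ⟨N, hN, 1, le_rfl, ?_⟩
    rw [amortisedNumber_one_right, Nat.cast_one, one_mul]
    exact (Nat.cast_le.2 (exchangeNumber_le hB)).trans hle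
  · intro H
    rw [blockOneIsMM_iff_exchangeExponent_eq_zero]
    refine le_antisymm ?_ exchangeExponent_nonneg
    refine le_of_forall_pos_le_add fun θ hθ => ?_
    rw [zero_add]
    obtain ⟨N, hN, m, hm, hle⟩ := H θ hθ
    have hN' : (0 : ℝ) < N := by exact_mod_cast hN
    have hm' : (0 : ℝ) < m := by exact_mod_cast hm
    have ha : (0 : ℝ) < amortisedNumber N m := by
      have := succ_le_amortisedNumber hN hm
      exact_mod_cast (show 0 < amortisedNumber N m by omega)
    have key := exchangeExponent_le_of_amortisedNumber (N := N) (m := m) (by omega) (by omega)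
    have hlog : Real.logb 2 ((amortisedNumber N m : ℝ) / m) ≤ θ * N := by
      rw [Real.logb_le_iff_le_rpow one_lt_two (div_pos ha hm'), div_le_iff₀ hm', mul_comm]
      exact hle
    calc exchangeExponent ≤ Real.logb 2 ((amortisedNumber N m : ℝ) / m) / N := key
      _ ≤ θ * N / N := div_le_div_of_nonneg_right hlog hN'.le
      _ = θ := mul_div_cancel_right₀ θ hN'.ne'

end Summit.MatrixMultiplication.MatrixMultiplication.Theorems.OutsiderSandwichAmortisedLaws
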